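import Mathlib
import Literature.NumberTheory.EllipticCurves.MordellCurvePhiDescentHom
import Summits.BirchSwinnertonDyer.BirchSwinnertonDyer.Theorems.Rank2ObservatoryThreeIsoKField
import Summits.BirchSwinnertonDyer.BirchSwinnertonDyer.Theorems.Rank2ObservatoryThreeIsoUFD
import Summits.BirchSwinnertonDyer.BirchSwinnertonDyer.Theorems.Rank2ObservatoryThreeIsoNormCut

/-!
# BirchSwinnertonDyer — rank ≥ 2 observatory, KERNEL-3ISO (B3b-2b): the `Ê`-side class bound

HONEST FRAMING: per-curve certified theorems and census instruments; no claim on BSD in rank ≥ 2.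

The support law WITH NORM CUT for the `Ê`-side 3-descent value `δ₀ = t - θ₀C ∈ 𝓞 K`,
`K = ℚ(ζ₃)` (Cohen, *Number Theory I*, Prop. 8.4.8 (3): the image of the 3-descent map lies in
the classes "whose norm is trivial in `ℚ×/ℚ×³`"; Cohen–Pazuki, arXiv:0903.4963, Prop. 2.2).
Inputs: the integral normal form (`Rank2ObservatoryThreeIsoIntegral`), the PID cube lemma
(`Rank2ObservatoryThreeIsoUFD`), the conjugation / units / exponent-uniqueness facts
(`Rank2ObservatoryThreeIsoNormCut`) and the support algebra `not_dvd_both_of_good`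
(`Rank2ObservatoryThreeIsoKField`).

* `common_prime_mem`, `common_prime_mem_int` — a factorisation `2θ₀s₁ = v ∏_{q∈P} q^{a_q}` controls
  the common primes of `δ₀, ε₀` (hypothesis `hcommon` of the cube lemma);
* `exists_normCut_class` — `[δ₀] = [ζ^j ∏_{q∈P} q^{k_q}]` with `k_q < 3` and
  `k_q + k_{c q} ≡ 0 (mod 3)` for the conjugation partner `c` — hence at most
  `3^{1 + #{split pairs in P}}` classes per row (e.g. 9 for 5427b1, 3 for 5814k2).

No definitions. References: H. Cohen, *Number Theory I* (GTM 239, 2007), Prop. 8.4.8 (3);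
H. Cohen, F. Pazuki, arXiv:0903.4963, Prop. 2.2.
-/

set_option linter.dupNamespace false

noncomputable section

open NumberField

namespace Summit.BirchSwinnertonDyer.BirchSwinnertonDyer.Rank2Observatory.ThreeIso

open Literature.NumberTheory.EllipticCurves.MordellDescent

section Common

variable {R : Type*} [CommRing R] [IsDomain R]

/-- **Controlled common primes.** With `B² + 3C² = A³`, `C = m₁AE + s₁E³`, `gcd(A, E) = 1` and a
factorisation `2θs₁ = v · ∏_{q ∈ P} q^{a_q}`, every common prime divisor of `B - θC` and `B + θC`
is associated to a member of `P` (from `not_dvd_both_of_good`).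
[cite: CohenPazuki2009, Prop. 2.2; Cohen2007NumberTheoryI, Prop. 8.4.8 (3)] -/
theorem common_prime_mem (P : Finset R) (hP : ∀ q ∈ P, Prime q) {θ A B C E m₁ s₁ : R}
    (v : Rˣ) (a : R → ℕ) (hN : B ^ 2 + 3 * C ^ 2 = A ^ 3) (hC : C = m₁ * A * E + s₁ * E ^ 3)
    (hAE : IsCoprime A E) (hfac : 2 * θ * s₁ = v * ∏ q ∈ P, q ^ a q) :
    ∀ π : R, Prime π → π ∣ B - θ * C → π ∣ B + θ * C → ∃ q ∈ P, Associated π q := by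
  intro π hπ h₁ h₂
  refine Classical.by_contradiction fun hnone =>
    not_dvd_both_of_good hπ hN hC hAE (fun hd => ?_) h₁ h₂
  rw [hfac] at hd
  rcases hπ.dvd_or_dvd hd with hd | hd
  · exact hπ.not_unit (isUnit_of_dvd_unit hd v.isUnit)
  · obtain ⟨q, hq, hdq⟩ := hπ.exists_mem_finset_dvd hd
    exact hnone ⟨q, hq,
      hπ.irreducible.associated_of_dvd (hP q hq).irreducible (hπ.dvd_of_dvd_pow hdq)⟩

end Common

section ClassBound

variable {K : Type*} [Field K]

/-- Integer packaging of `common_prime_mem` for the data of `exists_ringOfIntegers_descent_value`: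
`A = n`, `B = t`, `E = e`, `m₁ = 3m`, `s₁ = 81s - 12m³`, `C = 3mne + s₁e³`.
[cite: CohenPazuki2009, Prop. 2.2] -/
theorem common_prime_mem_int {θ₀ : 𝓞 K} {m s n t e : ℤ} (hne : IsCoprime n e)
    (hN : t ^ 2 + 3 * (3 * m * n * e + (81 * s - 12 * m ^ 3) * e ^ 3) ^ 2 = n ^ 3)
    (P : Finset (𝓞 K)) (hP : ∀ q ∈ P, Prime q) (v : (𝓞 K)ˣ) (a : 𝓞 K → ℕ)
    (hfac : 2 * θ₀ * ((81 * s - 12 * m ^ 3 : ℤ) : 𝓞 K) = v * ∏ q ∈ P, q ^ a q) :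
    ∀ π : 𝓞 K, Prime π →
      π ∣ (t : 𝓞 K) - θ₀ * ((3 * m * n * e + (81 * s - 12 * m ^ 3) * e ^ 3 : ℤ) : 𝓞 K) →
      π ∣ (t : 𝓞 K) + θ₀ * ((3 * m * n * e + (81 * s - 12 * m ^ 3) * e ^ 3 : ℤ) : 𝓞 K) →
      ∃ q ∈ P, Associated π q := by
  have hN' : (t : 𝓞 K) ^ 2 + 3 * (((3 * m * n * e + (81 * s - 12 * m ^ 3) * e ^ 3 : ℤ) : 𝓞 K)) ^ 2
      = (n : 𝓞 K) ^ 3 := by exact_mod_cast congrArg (Int.cast : ℤ → 𝓞 K) hN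
  have hC : (((3 * m * n * e + (81 * s - 12 * m ^ 3) * e ^ 3 : ℤ) : 𝓞 K))
      = ((3 * m : ℤ) : 𝓞 K) * (n : 𝓞 K) * (e : 𝓞 K) + ((81 * s - 12 * m ^ 3 : ℤ) : 𝓞 K) * (e : 𝓞 K) ^ 3 := by
    push_cast; ring
  have hAE : IsCoprime (n : 𝓞 K) (e : 𝓞 K) := by
    simpa only [eq_intCast] using hne.map (Int.castRingHom (𝓞 K))
  exact common_prime_mem P hP v a hN' hC hAE hfac

variable [NumberField K] [IsCyclotomicExtension {3} ℚ K]

/-- **The `Ê`-side support law with norm cut** (Cohen, *Number Theory I*, Prop. 8.4.8 (3);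
Cohen–Pazuki, Prop. 2.2), in `𝓞 K`, `K = ℚ(ζ₃)`: let `δ₀ = t - θ₀C`, `ε₀ = t + θ₀C = σ(δ₀)` with
`δ₀ε₀ = n³`, let `P` be a finite family of pairwise non-associated primes, stable under a conjugation
partner map `c` (`σ q ~ c q`), containing (up to association) every common prime divisor of `δ₀, ε₀`.
Then `[δ₀] = [ζ^j · ∏_{q ∈ P} q^{k_q}]` in `K×/K×³` with `k_q < 3` and the NORM CUT
`k_q + k_{c q} ≡ 0 (mod 3)` — so self-conjugate bad primes carry exponent `0` and a split pair
`π, π̄` carries `(a, 3 - a)`: at most `3^{1 + #{split pairs}}` classes.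
[cite: Cohen2007NumberTheoryI, Prop. 8.4.8 (3); CohenPazuki2009, Prop. 2.2] -/
theorem exists_normCut_class {ζ : K} (hζ : IsPrimitiveRoot ζ 3) (σ : K ≃ₐ[ℚ] K)
    (hσ : σ ζ = ζ ^ 2) {θ₀ δ₀ ε₀ : 𝓞 K} {t C n : ℤ} (hθ₀ : (θ₀ : K) = 2 * ζ + 1)
    (hδ₀ : δ₀ = t - θ₀ * C) (hε₀ : ε₀ = t + θ₀ * C) (hprod : δ₀ * ε₀ = (n : 𝓞 K) ^ 3)
    (hδ : δ₀ ≠ 0) (hε : ε₀ ≠ 0) (P : Finset (𝓞 K)) (hP : ∀ q ∈ P, Prime q)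
    (hna : ∀ q ∈ P, ∀ q' ∈ P, Associated q q' → q = q') (c : 𝓞 K → 𝓞 K)
    (hcP : ∀ q ∈ P, c q ∈ P) (hcc : ∀ q ∈ P, c (c q) = q)
    (hcσ : ∀ q ∈ P, Associated (RingOfIntegers.mapRingEquiv (σ : K ≃+* K) q) (c q))
    (hcommon : ∀ π : 𝓞 K, Prime π → π ∣ δ₀ → π ∣ ε₀ → ∃ q ∈ P, Associated π q) :
    ∃ (j : ℕ) (k : 𝓞 K → ℕ), j < 3 ∧ (∀ q, k q < 3) ∧ (∀ q ∈ P, (k q + k (c q)) % 3 = 0) ∧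
      cubeClass (δ₀ : K) = cubeClass (ζ ^ j * ∏ q ∈ P, ((q : 𝓞 K) : K) ^ k q) := by
  classical
  haveI : IsPrincipalIdealRing (𝓞 K) := IsCyclotomicExtension.Rat.three_pid K
  set σ₀ : 𝓞 K ≃+* 𝓞 K := RingOfIntegers.mapRingEquiv (σ : K ≃+* K) with hσ₀def
  have hσ₀K : ∀ x : 𝓞 K, ((σ₀ x : 𝓞 K) : K) = σ (x : K) := fun x => rfl
  -- `σ₀ θ₀ = -θ₀`, hence `σ₀ δ₀ = ε₀`
  have hσθ : σ₀ θ₀ = -θ₀ := by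
    apply RingOfIntegers.coe_injective
    change ((σ₀ θ₀ : 𝓞 K) : K) = ((-θ₀ : 𝓞 K) : K)
    rw [hσ₀K, show ((-θ₀ : 𝓞 K) : K) = -(θ₀ : K) from map_neg (algebraMap (𝓞 K) K) θ₀, hθ₀]
    exact conj_theta hζ σ hσ
  have hσδ : σ₀ δ₀ = ε₀ := by
    rw [hδ₀, hε₀, map_sub, map_mul, map_intCast, map_intCast, hσθ]; ring
  -- the PID cube lemma
  obtain ⟨u, k, w, hk3, hδw⟩ := exists_eq_unit_mul_prod_pow_lt_mul_cube P hP hδ hε hprod hcommon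
  have hw : w ≠ 0 := by
    rintro rfl; apply hδ; rw [hδw]; ring
  -- the class of `δ₀` in `K×/K×³`
  obtain ⟨j, hj, sgn, hsgn, huK⟩ := unit_eq_sign_mul_pow hζ u
  have hBK : (((∏ q ∈ P, q ^ k q : 𝓞 K)) : K) = ∏ q ∈ P, ((q : 𝓞 K) : K) ^ k q := by
    rw [RingOfIntegers.coe_eq_algebraMap, map_prod]
    simp only [map_pow]
  have hB0 : (∏ q ∈ P, ((q : 𝓞 K) : K) ^ k q) ≠ 0 := by
    refine Finset.prod_ne_zero_iff.mpr fun q hq => pow_ne_zero _ fun h0 => ?_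
    exact (hP q hq).ne_zero (RingOfIntegers.coe_eq_zero_iff.mp h0)
  have hwK : (w : K) ≠ 0 := fun h0 => hw (RingOfIntegers.coe_eq_zero_iff.mp h0)
  have hζ0 : ζ ≠ 0 := hζ.ne_zero (by norm_num)
  have hsgn0 : sgn ≠ 0 := by rcases hsgn with rfl | rfl <;> norm_num
  have hclass : cubeClass (δ₀ : K) = cubeClass (ζ ^ j * ∏ q ∈ P, ((q : 𝓞 K) : K) ^ k q) := by
    have h1 : (δ₀ : K) = sgn * (ζ ^ j * ∏ q ∈ P, ((q : 𝓞 K) : K) ^ k q) * (w : K) ^ 3 := by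
      have hval : ∀ x y : 𝓞 K, ((x * y : 𝓞 K) : K) = (x : K) * (y : K) := fun x y =>
        map_mul (algebraMap (𝓞 K) K) x y
      have hval3 : ∀ x : 𝓞 K, ((x ^ 3 : 𝓞 K) : K) = (x : K) ^ 3 := fun x =>
        map_pow (algebraMap (𝓞 K) K) x 3
      rw [hδw, hval, hval, hval3, hBK, huK]; ring
    rw [h1, cubeClass_mul_pow_three (mul_ne_zero hsgn0 (mul_ne_zero (pow_ne_zero _ hζ0) hB0)) hwK]
    rcases hsgn with rfl | rfl
    · rw [one_mul]
    · rw [neg_one_mul, cubeClass_neg]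
  -- the norm cut: expand `ε₀ = σ₀ δ₀`
  have hassoc : Associated (∏ q ∈ P, σ₀ q ^ k q) (∏ q ∈ P, c q ^ k q) := by
    rw [← Associates.mk_eq_mk_iff_associated, ← Associates.mkMonoidHom_apply,
      ← Associates.mkMonoidHom_apply, map_prod, map_prod]
    refine Finset.prod_congr rfl fun q hq => ?_
    rw [map_pow, map_pow, Associates.mkMonoidHom_apply, Associates.mkMonoidHom_apply,
      Associates.mk_eq_mk_iff_associated.mpr (hcσ q hq)]
  obtain ⟨V, hV⟩ := hassoc
  have hreindex : (∏ q ∈ P, c q ^ k q) = ∏ q ∈ P, q ^ k (c q) := by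
    refine Finset.prod_nbij' c c hcP hcP hcc hcc fun q hq => ?_
    rw [hcc q hq]
  have hεexp : ε₀ = σ₀ (u : 𝓞 K) * (∏ q ∈ P, σ₀ q ^ k q) * σ₀ w ^ 3 := by
    rw [← hσδ, hδw, map_mul, map_mul, map_pow, map_prod]
    simp only [map_pow]
  -- strip the `P`-parts of `w · σ₀ w` and of `n`
  have hσw : σ₀ w ≠ 0 := (map_ne_zero_iff σ₀ σ₀.injective).mpr hw
  have hPnu : ∀ q ∈ P, ¬IsUnit q := fun q hq => (hP q hq).not_unit
  obtain ⟨jx, m', hm₀eq, hm'0, hm'free⟩ :=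
    exists_prod_pow_mul_not_dvd P hPnu (mul_ne_zero hw hσw)
  have hn0 : (n : 𝓞 K) ≠ 0 := by
    intro h0
    rw [h0] at hprod
    exact mul_ne_zero hδ hε (by rw [hprod]; ring)
  obtain ⟨ix, n', hneq, hn'0, hn'free⟩ := exists_prod_pow_mul_not_dvd P hPnu hn0
  have hm'3 : ∀ q ∈ P, ¬q ∣ m' ^ 3 := fun q hq h => hm'free q hq ((hP q hq).dvd_of_dvd_pow h)
  have hn'3 : ∀ q ∈ P, ¬q ∣ n' ^ 3 := fun q hq h => hn'free q hq ((hP q hq).dvd_of_dvd_pow h)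
  -- the unit `u · σ₀ u`
  obtain ⟨U, hU⟩ := (u.isUnit.mul (u.isUnit.map σ₀))
  -- the exponent identity
  have e1 : (∏ q ∈ P, q ^ (k q + k (c q) + 3 * jx q)) =
      (∏ q ∈ P, q ^ k q) * (∏ q ∈ P, q ^ k (c q)) * (∏ q ∈ P, q ^ jx q) ^ 3 := by
    rw [← Finset.prod_pow, ← Finset.prod_mul_distrib, ← Finset.prod_mul_distrib]
    refine Finset.prod_congr rfl fun q _ => ?_
    ring
  have e2 : (∏ q ∈ P, q ^ (3 * ix q)) = (∏ q ∈ P, q ^ ix q) ^ 3 := by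
    rw [← Finset.prod_pow]
    refine Finset.prod_congr rfl fun q _ => ?_
    ring
  have heq : (U : 𝓞 K) * (∏ q ∈ P, q ^ (k q + k (c q) + 3 * jx q)) * m' ^ 3 =
      (V : 𝓞 K) * (∏ q ∈ P, q ^ (3 * ix q)) * n' ^ 3 := by
    calc (U : 𝓞 K) * (∏ q ∈ P, q ^ (k q + k (c q) + 3 * jx q)) * m' ^ 3
        = ((u : 𝓞 K) * σ₀ (u : 𝓞 K)) * ((∏ q ∈ P, q ^ k q) * (∏ q ∈ P, q ^ k (c q))) *
            ((∏ q ∈ P, q ^ jx q) * m') ^ 3 := by rw [hU, e1]; ring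
      _ = ((u : 𝓞 K) * (∏ q ∈ P, q ^ k q) * w ^ 3) *
            (σ₀ (u : 𝓞 K) * ((∏ q ∈ P, σ₀ q ^ k q) * (V : 𝓞 K)) * σ₀ w ^ 3) := by
          rw [hV, hreindex, ← hm₀eq]; ring
      _ = δ₀ * ε₀ * (V : 𝓞 K) := by rw [hδw, hεexp]; ring
      _ = (V : 𝓞 K) * (∏ q ∈ P, q ^ (3 * ix q)) * n' ^ 3 := by rw [hprod, hneq, e2]; ring
  have hexp := prod_pow_exponents_unique P hP hna U V _ _ hm'3 hn'3 heq
  refine ⟨j, k, hj, hk3, fun q hq => ?_, hclass⟩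
  have := hexp q hq
  omega

end ClassBound

end Summit.BirchSwinnertonDyer.BirchSwinnertonDyer.Rank2Observatory.ThreeIso
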